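import Literature.Analysis.FluidPDE.CriticalRegularity
import HarnessLib

/-!
# Gallagher–Koch–Planchon blow-up: `limsup` form versus `sup` form (proofs)

Sibling proof file of `Literature/Analysis/FluidPDE/CriticalRegularity.lean` (named fact
`Literature.Analysis.FluidPDE.gkp_besov_blowup`, Gallagher–Koch–Planchon 2016, Thm. 1). Everything here is proved.

* **Subadditivity of the Littlewood–Paley norms** (BCD Def. 2.15): the distributional
  `L^p` norm `Literature.Analysis.FunctionSpaces.eLpNormDistrib` and the homogeneous Besov norm `Literature.eHomBesovNorm s p q`
  (`1 ≤ q`) satisfy the triangle inequality and are invariant under `u ↦ -u`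
  (`eLpNormDistrib_add_le`, `eHomBesovNorm_add_le`, `eHomBesovNorm_neg`,
  `eHomBesovNorm_le_add_sub`).
* **Bridges between `limsup_{t → T⁻}` and `sup_{[0,T)}`** for a time family of distributions:
  `limsup ≤ sup` always (`limsup_nhdsLT_le_biSup_Ico`), and for a family continuous in
  `Ḃ^s_{p,q}` on `[0, T)` a finite `limsup` at `T⁻` forces a finite `sup` on `[0, T)`
  (`ContinuousInHomBesovOn.biSup_lt_top_of_limsup_lt_top`: compactness of `[0, T₀]` plus the
  triangle inequality).
* **GKP in `sup` form.** GKP phrase the result both as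
  `limsup_{t → T*} ‖u(t)‖_{Ḃ^{s_p}_{p,q}} = ∞` (Thm. 1, p. 5 of arXiv:1407.4156) and as
  "`sup_{0<t<T*} ‖u(t)‖_X = ∞`" / "the norm becomes unbounded" (the Question of §1.1 and the
  abstract). `Literature.Analysis.FluidPDE.gkp_besov_blowup.biSup_eq_top` is the `sup`-form corollary of the named fact
  `Literature.Analysis.FluidPDE.gkp_besov_blowup` (the shape consumed by continuation criteria stated with
  `⨆ t ∈ Ico 0 T`, e.g. route NavierStokesRegularity/MonotoneCritical), and
  `Literature.Analysis.FluidPDE.gkp_besov_blowup_iff_biSup` proves the two renderings equivalent (the solution class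
  `IsBesovMildSolutionOn` is continuous in `Ḃ^{s_p}_{p,q}` on `[0, T*)`). No new named fact is
  introduced.
* `Literature.Analysis.FluidPDE.gkp_besov_blowup_of_albritton`: Albritton's `lim` form (`albritton_besov_blowup`,
  Albritton 2018, Thm. 1.1) implies GKP's `limsup` form.

## Status of the named fact `gkp_besov_blowup` (not discharged here)

GKP's proof is a theory, not a lemma: by §2.1 (p. 6 of arXiv:1407.4156), after the reduction
to `p = q = 3·2^k - 2` (embedding (1.1) and the `(p,q)`-independence (1.9) of `T*`), Theorem 1
is "an immediate corollary" of Prop. 2.1 (existence of a critical element, `A_c < ∞ ⇒ 𝒟_c ≠ ∅`),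
Prop. 2.2 (critical elements tend to `0` in `𝓢'` at blow-up time) and Prop. 2.3 (rigidity:
bounded critical norm and `NS(u₀)(t) → 0` in `𝓢'` force `T* = ∞`), which rest on profile
decompositions in `Ḃ^{s_p}_{p,p}` (Thms. 2–3), a perturbation theory for (NS) (App. A),
backward uniqueness / unique continuation / `ε`-regularity, and the Besov-space Cauchy theory
of §1.2 — none of which exists in Mathlib or in this tree (the local existence statement is the
unproved fact `NS.exists_isBesovMildSolutionOn`). Moreover the critical element's datum is a
general element of `Ḃ^{s_p}_{p,p} ⊂ 𝓢'`, whereas the solution classes of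
`CriticalRegularity.lean` are function-valued (`NS.IsDistributionOf`), so Props. 2.1–2.2 can only
be rendered for function-valued data (time translates `NS(u₀)(s)`, `0 < s < T*`, of a critical
element are again critical elements and are smooth, GKP §2.4 and (1.6)); that rendering, with
the §2.1 reduction proved from the three propositions taken as named facts, is the business of a
sibling file. This file only supplies the provable bookkeeping around the fact.

## References

* I. Gallagher, G. S. Koch, F. Planchon, *Blow-up of critical Besov norms at a potential
  Navier–Stokes singularity*, Comm. Math. Phys. 343 (2016) 39–82 (arXiv:1407.4156), Thm. 1,
  §1.1 (Question), §2.1.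
* D. Albritton, *Blow-up criteria for the Navier–Stokes equations in non-endpoint critical Besov
  spaces*, Anal. PDE 11 (2018) 1415–1456, Thm. 1.1.
* H. Bahouri, J.-Y. Chemin, R. Danchin, *Fourier Analysis and Nonlinear PDE* (2011), Def. 2.15,
  §2.3 ("BCD").
-/

noncomputable section

open MeasureTheory TemperedDistribution Set Function Filter Topology
open scoped SchwartzMap ENNReal NNReal

namespace Literature.Analysis.FluidPDE

/-! ## Subadditivity of the Littlewood–Paley norms -/

section BesovAlgebra

variable {E F : Type*} [NormedAddCommGroup E] [InnerProductSpace ℝ E] [FiniteDimensional ℝ E]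
  [MeasurableSpace E] [BorelSpace E] [NormedAddCommGroup F] [NormedSpace ℂ F] [CompleteSpace F]

/-- The embedding `L^p → 𝓢'` is additive (Mathlib's `Lp.toTemperedDistributionCLM`). [folklore] -/
theorem coe_add_Lp {p : ℝ≥0∞} [Fact (1 ≤ p)] (f g : Lp F p (volume : Measure E)) :
    ((f + g : Lp F p (volume : Measure E)) : 𝓢'(E, F)) = (f : 𝓢'(E, F)) + (g : 𝓢'(E, F)) := by
  rw [← Lp.toTemperedDistributionCLM_apply, map_add, Lp.toTemperedDistributionCLM_apply,
    Lp.toTemperedDistributionCLM_apply]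

/-- The embedding `L^p → 𝓢'` commutes with negation (Mathlib's `Lp.toTemperedDistributionCLM`).
[folklore] -/
theorem coe_neg_Lp {p : ℝ≥0∞} [Fact (1 ≤ p)] (f : Lp F p (volume : Measure E)) :
    ((-f : Lp F p (volume : Measure E)) : 𝓢'(E, F)) = -(f : 𝓢'(E, F)) := by
  rw [← Lp.toTemperedDistributionCLM_apply, map_neg, Lp.toTemperedDistributionCLM_apply]

/-- Triangle inequality for the distributional `L^p` norm:
`‖u + v‖_{L^p} ≤ ‖u‖_{L^p} + ‖v‖_{L^p}` in `[0, ∞]` (BCD §1.1; if one of `u`, `v` is not an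
`L^p` function the right-hand side is `∞`). [folklore] -/
theorem eLpNormDistrib_add_le {p : ℝ≥0∞} [Fact (1 ≤ p)] (u v : 𝓢'(E, F)) :
    FunctionSpaces.eLpNormDistrib p (u + v) ≤ FunctionSpaces.eLpNormDistrib p u + FunctionSpaces.eLpNormDistrib p v := by
  by_cases hu : ∃ f : Lp F p (volume : Measure E), (f : 𝓢'(E, F)) = u
  · by_cases hv : ∃ g : Lp F p (volume : Measure E), (g : 𝓢'(E, F)) = v
    · obtain ⟨f, rfl⟩ := hu
      obtain ⟨g, rfl⟩ := hv
      rw [FunctionSpaces.eLpNormDistrib_coe, FunctionSpaces.eLpNormDistrib_coe, ← coe_add_Lp, FunctionSpaces.eLpNormDistrib_coe]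
      exact enorm_add_le f g
    · push Not at hv
      rw [FunctionSpaces.eLpNormDistrib_of_forall_ne hv, add_top]
      exact le_top
  · push Not at hu
    rw [FunctionSpaces.eLpNormDistrib_of_forall_ne hu, top_add]
    exact le_top

/-- `‖-u‖_{L^p} ≤ ‖u‖_{L^p}` for the distributional `L^p` norm (BCD §1.1). [folklore] -/
theorem eLpNormDistrib_neg_le {p : ℝ≥0∞} [Fact (1 ≤ p)] (u : 𝓢'(E, F)) :
    FunctionSpaces.eLpNormDistrib p (-u) ≤ FunctionSpaces.eLpNormDistrib p u := by
  refine le_iInf₂ fun f hf => ?_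
  calc FunctionSpaces.eLpNormDistrib p (-u) ≤ ‖-f‖ₑ :=
        iInf₂_le_of_le (-f) (by rw [coe_neg_Lp, hf]) le_rfl
    _ = ‖f‖ₑ := enorm_neg f

/-- The distributional `L^p` norm is invariant under `u ↦ -u` (BCD §1.1). [folklore] -/
@[simp]
theorem eLpNormDistrib_neg {p : ℝ≥0∞} [Fact (1 ≤ p)] (u : 𝓢'(E, F)) :
    FunctionSpaces.eLpNormDistrib p (-u) = FunctionSpaces.eLpNormDistrib p u :=
  le_antisymm (eLpNormDistrib_neg_le u) (by simpa using eLpNormDistrib_neg_le (-u))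

/-- Subadditivity of the weighted dyadic pieces `2^{js} ‖Δ̇_j u‖_{L^p}` (BCD Def. 2.15; `Δ̇_j`
is linear). [folklore] -/
theorem lpBlockWeight_add_le (s : ℝ) (p : ℝ≥0∞) [Fact (1 ≤ p)] (u v : 𝓢'(E, F)) (j : ℤ) :
    FunctionSpaces.lpBlockWeight s p (u + v) j ≤ FunctionSpaces.lpBlockWeight s p u j + FunctionSpaces.lpBlockWeight s p v j := by
  simp only [FunctionSpaces.lpBlockWeight, map_add, ← mul_add]
  gcongr
  exact eLpNormDistrib_add_le _ _

/-- The weighted dyadic pieces are invariant under `u ↦ -u` (BCD Def. 2.15). [folklore] -/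
@[simp]
theorem lpBlockWeight_neg (s : ℝ) (p : ℝ≥0∞) [Fact (1 ≤ p)] (u : 𝓢'(E, F)) (j : ℤ) :
    FunctionSpaces.lpBlockWeight s p (-u) j = FunctionSpaces.lpBlockWeight s p u j := by
  simp only [FunctionSpaces.lpBlockWeight, map_neg, eLpNormDistrib_neg]

/-- **Triangle inequality for the homogeneous Besov norm**, `1 ≤ q`:
`‖u + v‖_{Ḃ^s_{p,q}} ≤ ‖u‖_{Ḃ^s_{p,q}} + ‖v‖_{Ḃ^s_{p,q}}` in `[0, ∞]` (BCD Def. 2.15: a norm;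
Minkowski in `ℓ^q(ℤ)` on top of `lpBlockWeight_add_le`).
[folklore] -/
theorem eHomBesovNorm_add_le (s : ℝ) (p : ℝ≥0∞) {q : ℝ≥0∞} [Fact (1 ≤ p)] (hq : 1 ≤ q)
    (u v : 𝓢'(E, F)) :
    FunctionSpaces.eHomBesovNorm s p q (u + v) ≤ FunctionSpaces.eHomBesovNorm s p q u + FunctionSpaces.eHomBesovNorm s p q v := by
  unfold FunctionSpaces.eHomBesovNorm
  calc eLpNorm (FunctionSpaces.lpBlockWeight s p (u + v)) q Measure.count
      ≤ eLpNorm (FunctionSpaces.lpBlockWeight s p u + FunctionSpaces.lpBlockWeight s p v) q Measure.count :=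
        eLpNorm_mono_enorm fun j => by
          simpa only [enorm_eq_self, Pi.add_apply] using lpBlockWeight_add_le s p u v j
    _ ≤ eLpNorm (FunctionSpaces.lpBlockWeight s p u) q Measure.count +
          eLpNorm (FunctionSpaces.lpBlockWeight s p v) q Measure.count :=
        eLpNorm_add_le (Measurable.of_discrete).aestronglyMeasurable
          (Measurable.of_discrete).aestronglyMeasurable hq

/-- The homogeneous Besov norm is invariant under `u ↦ -u` (BCD Def. 2.15). [folklore] -/
@[simp]
theorem eHomBesovNorm_neg (s : ℝ) (p q : ℝ≥0∞) [Fact (1 ≤ p)] (u : 𝓢'(E, F)) :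
    FunctionSpaces.eHomBesovNorm s p q (-u) = FunctionSpaces.eHomBesovNorm s p q u := by
  unfold FunctionSpaces.eHomBesovNorm
  congr 1
  funext j
  exact lpBlockWeight_neg s p u j

/-- `‖u - v‖_{Ḃ^s_{p,q}} = ‖v - u‖_{Ḃ^s_{p,q}}` (BCD Def. 2.15). [folklore] -/
theorem eHomBesovNorm_sub_comm (s : ℝ) (p q : ℝ≥0∞) [Fact (1 ≤ p)] (u v : 𝓢'(E, F)) :
    FunctionSpaces.eHomBesovNorm s p q (u - v) = FunctionSpaces.eHomBesovNorm s p q (v - u) := by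
  rw [← neg_sub, eHomBesovNorm_neg]

/-- `‖u‖_{Ḃ^s_{p,q}} ≤ ‖v‖_{Ḃ^s_{p,q}} + ‖u - v‖_{Ḃ^s_{p,q}}` for `1 ≤ q` (BCD Def. 2.15).
[folklore] -/
theorem eHomBesovNorm_le_add_sub (s : ℝ) (p : ℝ≥0∞) {q : ℝ≥0∞} [Fact (1 ≤ p)] (hq : 1 ≤ q)
    (u v : 𝓢'(E, F)) :
    FunctionSpaces.eHomBesovNorm s p q u ≤ FunctionSpaces.eHomBesovNorm s p q v + FunctionSpaces.eHomBesovNorm s p q (u - v) := by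
  calc FunctionSpaces.eHomBesovNorm s p q u = FunctionSpaces.eHomBesovNorm s p q (v + (u - v)) := by rw [add_sub_cancel]
    _ ≤ _ := eHomBesovNorm_add_le s p hq v (u - v)

/-- A distribution in `Ḃ^s_{p,q}` stays at finite Besov distance from exactly the distributions of
finite Besov norm, quantitatively: `‖u‖ ≤ ‖v‖ + ‖u - v‖ < ∞` (BCD Def. 2.15). [folklore] -/
theorem eHomBesovNorm_lt_top_of_sub {s : ℝ} {p q : ℝ≥0∞} [Fact (1 ≤ p)] (hq : 1 ≤ q)
    {u v : 𝓢'(E, F)} (hv : FunctionSpaces.eHomBesovNorm s p q v < ∞) (huv : FunctionSpaces.eHomBesovNorm s p q (u - v) < ∞) :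
    FunctionSpaces.eHomBesovNorm s p q u < ∞ :=
  (eHomBesovNorm_le_add_sub s p hq u v).trans_lt (ENNReal.add_lt_top.2 ⟨hv, huv⟩)

end BesovAlgebra

/-! ## `limsup` at `T⁻` versus `sup` on `[0, T)` -/

section Bridges

/-- `limsup_{t → T⁻} f(t) ≤ sup_{t ∈ [0,T)} f(t)` for `0 < T` (the left neighbourhoods of `T`
eventually lie in `[0, T)`). [folklore] -/
theorem limsup_nhdsLT_le_biSup_Ico {f : ℝ → ℝ≥0∞} {T : ℝ} (hT : 0 < T) :
    limsup f (𝓝[<] T) ≤ ⨆ t ∈ Ico 0 T, f t :=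
  limsup_le_of_le (by isBoundedDefault) <| (eventually_mem_set.2 (Ico_mem_nhdsLT hT)).mono
    fun t ht => le_iSup₂ (f := fun (t : ℝ) (_ : t ∈ Ico 0 T) => f t) t ht

variable {ι : Type*} [Fintype ι]

/-- **Continuity turns a finite `limsup` into a finite `sup`.** If `U ∈ C([0,T); Ḃ^s_{p,q})`
(`NS.ContinuousInHomBesovOn`, `1 ≤ q`) and `limsup_{t → T⁻} ‖U t‖_{Ḃ^s_{p,q}} < ∞`, then
`sup_{t ∈ [0,T)} ‖U t‖_{Ḃ^s_{p,q}} < ∞`: near `T` the norm is eventually bounded, and on the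
remaining compact interval `[0, T₀]` it is locally bounded by continuity and the triangle
inequality (GKP 2016, §1.1: the two phrasings "`limsup = ∞`" and "the norm becomes unbounded"
of Thm. 1). [folklore] -/
theorem ContinuousInHomBesovOn.biSup_lt_top_of_limsup_lt_top {s : ℝ} {p q : ℝ≥0∞}
    [Fact (1 ≤ p)] (hq : 1 ≤ q) {T : ℝ}
    {U : ℝ → 𝓢'(EuclideanSpace ℝ ι, EuclideanSpace ℂ ι)}
    (hU : FluidPDE.ContinuousInHomBesovOn (Ico 0 T) s p q U)
    (hlim : limsup (fun t => FunctionSpaces.eHomBesovNorm s p q (U t)) (𝓝[<] T) < ∞) :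
    ⨆ t ∈ Ico 0 T, FunctionSpaces.eHomBesovNorm s p q (U t) < ∞ := by
  set f : ℝ → ℝ≥0∞ := fun t => FunctionSpaces.eHomBesovNorm s p q (U t) with hf
  set L := limsup f (𝓝[<] T) with hL
  -- near `T`: eventually `f t < L + 1`
  have hev : ∀ᶠ t in 𝓝[<] T, f t < L + 1 :=
    eventually_lt_of_limsup_lt (ENNReal.lt_add_right hlim.ne one_ne_zero)
  obtain ⟨T₀, hT₀T, hT₀⟩ := mem_nhdsLT_iff_exists_Ioo_subset.1 hev
  rw [mem_Iio] at hT₀T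
  -- on the compact piece `[0, T₀] ⊆ [0, T)`: a finite bound by continuity
  have hsub : Icc 0 T₀ ⊆ Ico 0 T := fun t ht => ⟨ht.1, ht.2.trans_lt hT₀T⟩
  have hcpt : ∃ M : ℝ≥0∞, M < ∞ ∧ ∀ t ∈ Icc 0 T₀, f t ≤ M := by
    refine (isCompact_Icc (a := (0 : ℝ)) (b := T₀)).induction_on
      (p := fun S => ∃ M : ℝ≥0∞, M < ∞ ∧ ∀ t ∈ S, t ∈ Icc (0 : ℝ) T₀ → f t ≤ M) ?_ ?_ ?_ ?_
      |>.imp fun M hM => ⟨hM.1, fun t ht => hM.2 t ht ht⟩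
    · exact ⟨0, ENNReal.zero_lt_top, fun t ht => absurd ht (notMem_empty t)⟩
    · rintro S S' hSS' ⟨M, hM, h⟩
      exact ⟨M, hM, fun t ht ht' => h t (hSS' ht) ht'⟩
    · rintro S S' ⟨M, hM, h⟩ ⟨M', hM', h'⟩
      refine ⟨max M M', max_lt hM hM', fun t ht ht' => ?_⟩
      rcases ht with ht | ht
      · exact (h t ht ht').trans (le_max_left _ _)
      · exact (h' t ht ht').trans (le_max_right _ _)
    · intro x hx
      have hxT : x ∈ Ico 0 T := hsub hx
      -- continuity at `x` within `[0, T)`: eventually `‖U t - U x‖ < 1`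
      have hcont : ∀ᶠ t in 𝓝[Ico 0 T] x, FunctionSpaces.eHomBesovNorm s p q (U t - U x) < 1 :=
        (hU.2 x hxT).eventually (gt_mem_nhds zero_lt_one)
      refine ⟨{t | FunctionSpaces.eHomBesovNorm s p q (U t - U x) < 1}, nhdsWithin_mono x hsub hcont,
        f x + 1, ENNReal.add_lt_top.2 ⟨(hU.1 x hxT).eHomBesovNorm_lt_top, ENNReal.one_lt_top⟩,
        fun t ht _ => ?_⟩
      exact (eHomBesovNorm_le_add_sub s p hq (U t) (U x)).trans (add_le_add le_rfl (le_of_lt ht))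
  obtain ⟨M, hM, hMf⟩ := hcpt
  -- assemble
  refine lt_of_le_of_lt (iSup₂_le fun t ht => ?_) (max_lt hM (ENNReal.add_lt_top.2 ⟨hlim, ENNReal.one_lt_top⟩))
  rcases le_or_gt t T₀ with htT₀ | htT₀
  · exact (hMf t ⟨ht.1, htT₀⟩).trans (le_max_left _ _)
  · exact (hT₀ ⟨htT₀, ht.2⟩).le.trans (le_max_right _ _)

end Bridges

/-! ## GKP's Theorem 1 in `sup` form -/

section NS

/-- Local notation for physical space `ℝ³ = EuclideanSpace ℝ (Fin 3)`. -/
local notation "ℝ³" => EuclideanSpace ℝ (Fin 3)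

/-- Local notation for the complexified target `ℂ³ = EuclideanSpace ℂ (Fin 3)`. -/
local notation "ℂ³" => EuclideanSpace ℂ (Fin 3)

/-- GKP's `limsup` blow-up implies the `sup` blow-up on `[0, T*)` (`limsup ≤ sup`;
GKP 2016, Thm. 1 ⇒ the Question of §1.1). [cite: GKP2016, Thm. 1] -/
theorem gkp_besov_blowup.biSup_eq_top (h : gkp_besov_blowup) {ν : ℝ} (hν : 0 < ν) {p q : ℝ≥0∞}
    [Fact (1 ≤ p)] (hp₃ : 3 < p) (hp : p < ∞) (hq₃ : 3 < q) (hq : q < ∞) {T : ℝ} (hT : 0 < T)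
    {u : ℝ → ℝ³ → ℝ³} {U : ℝ → 𝓢'(ℝ³, ℂ³)}
    (hmax : IsMaximalBesovMildSolution (-1 + 3 / p.toReal) p q T ν u U) :
    ⨆ t ∈ Ico 0 T, FunctionSpaces.eHomBesovNorm (-1 + 3 / p.toReal) p q (U t) = ∞ :=
  eq_top_iff.2 <| (h hν hp₃ hp hq₃ hq hT hmax).symm.le.trans (limsup_nhdsLT_le_biSup_Ico hT)

/-- **Continuation form of GKP's Theorem 1**: if the critical Besov norm of a Besov mild
solution stays bounded on `[0, T)`, `sup_{t ∈ [0,T)} ‖U t‖_{Ḃ^{-1+3/p}_{p,q}} < ∞`, then `T` is not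
the maximal time, i.e. `(u, U)` is not a maximal Besov mild solution with lifespan `T`
(contrapositive of `gkp_besov_blowup.biSup_eq_top`; GKP 2016, Thm. 1 and the Question of §1.1:
"does `sup_{0<t<T*} ‖u‖_X < ∞` imply `T* = +∞`?"). [cite: GKP2016, Thm. 1] -/
theorem gkp_besov_blowup.not_isMaximalBesovMildSolution_of_biSup_lt_top (h : gkp_besov_blowup)
    {ν : ℝ} (hν : 0 < ν) {p q : ℝ≥0∞} [Fact (1 ≤ p)] (hp₃ : 3 < p) (hp : p < ∞) (hq₃ : 3 < q)
    (hq : q < ∞) {T : ℝ} (hT : 0 < T) {u : ℝ → ℝ³ → ℝ³} {U : ℝ → 𝓢'(ℝ³, ℂ³)}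
    (hsup : ⨆ t ∈ Ico 0 T, FunctionSpaces.eHomBesovNorm (-1 + 3 / p.toReal) p q (U t) < ∞) :
    ¬ IsMaximalBesovMildSolution (-1 + 3 / p.toReal) p q T ν u U :=
  fun hmax => hsup.ne (h.biSup_eq_top hν hp₃ hp hq₃ hq hT hmax)

/-- For a Besov mild solution on `[0, T)` with `1 ≤ q`, `sup_{[0,T)} ‖U t‖ = ∞` forces
`limsup_{t → T⁻} ‖U t‖ = ∞` (contrapositive of
`ContinuousInHomBesovOn.biSup_lt_top_of_limsup_lt_top`, using `U ∈ C([0,T); Ḃ^s_{p,q})`;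
GKP 2016, §1.1). [cite: GKP2016, §1.1] -/
theorem IsBesovMildSolutionOn.limsup_eq_top_of_biSup_eq_top {s : ℝ} {p q : ℝ≥0∞}
    [Fact (1 ≤ p)] (hq : 1 ≤ q) {T ν : ℝ} {u : ℝ → ℝ³ → ℝ³} {U : ℝ → 𝓢'(ℝ³, ℂ³)}
    (h : IsBesovMildSolutionOn s p q T ν u U)
    (hsup : ⨆ t ∈ Ico 0 T, FunctionSpaces.eHomBesovNorm s p q (U t) = ∞) :
    limsup (fun t => FunctionSpaces.eHomBesovNorm s p q (U t)) (𝓝[<] T) = ∞ := by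
  by_contra hne
  exact (h.continuousInHomBesovOn.biSup_lt_top_of_limsup_lt_top hq (lt_top_iff_ne_top.2 hne)).ne
    hsup

/-- **The two renderings of GKP's Theorem 1 agree**: the `limsup` form `gkp_besov_blowup`
(Thm. 1 as printed, p. 5) and the `sup` form "`sup_{t ∈ [0,T*)} ‖u(t)‖_{Ḃ^{-1+3/p}_{p,q}} = ∞`"
(the Question of §1.1 and the abstract: "the norm of the solution in that Besov space becomes
unbounded at time `T`") are equivalent in the bookkeeping of `CriticalRegularity.lean`, because
maximal Besov mild solutions are continuous in `Ḃ^{-1+3/p}_{p,q}` on `[0, T*)` and `q > 3 ≥ 1`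
(GKP 2016, Thm. 1 and §1.1). The right-hand side is spelled out rather than named, so that no
second named fact is created. [cite: GKP2016, Thm. 1] -/
theorem gkp_besov_blowup_iff_biSup :
    gkp_besov_blowup ↔
      ∀ {ν : ℝ}, 0 < ν → ∀ {p q : ℝ≥0∞} [Fact (1 ≤ p)], 3 < p → p < ∞ → 3 < q → q < ∞ →
        ∀ {T : ℝ}, 0 < T → ∀ {u : ℝ → ℝ³ → ℝ³} {U : ℝ → 𝓢'(ℝ³, ℂ³)},
          IsMaximalBesovMildSolution (-1 + 3 / p.toReal) p q T ν u U →
            ⨆ t ∈ Ico 0 T, FunctionSpaces.eHomBesovNorm (-1 + 3 / p.toReal) p q (U t) = ∞ := by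
  constructor
  · intro h ν hν p q _ hp₃ hp hq₃ hq T hT u U hmax
    exact h.biSup_eq_top hν hp₃ hp hq₃ hq hT hmax
  · intro h ν hν p q _ hp₃ hp hq₃ hq T hT u U hmax
    have hq₁ : 1 ≤ q := le_trans (by norm_num) hq₃.le
    exact hmax.isBesovMildSolutionOn.limsup_eq_top_of_biSup_eq_top hq₁
      (h hν hp₃ hp hq₃ hq hT hmax)

/-- **Albritton ⇒ GKP**: the `lim` form `albritton_besov_blowup` (Albritton 2018, Thm. 1.1)
implies the `limsup` form `gkp_besov_blowup` (GKP 2016, Thm. 1), since the `limsup` of a family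
tending to `∞` along the nontrivial filter `𝓝[<] T*` is `∞`. [cite: Albritton2018, Thm. 1.1] -/
theorem gkp_besov_blowup_of_albritton (h : albritton_besov_blowup) : gkp_besov_blowup :=
  fun hν _ _ _ hp₃ hp hq₃ hq _ hT _ _ hmax => (h hν hp₃ hp hq₃ hq hT hmax).limsup_eq

end NS

end Literature.Analysis.FluidPDE
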